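import Summits.QuantumFields.YangMills.Theorems.BalabanLadderIROddTorusCutWeightRP
import Literature.MathematicalPhysics.QuantumFieldTheory.ConstructiveQFTWave0CovariantRPProofs
import HarnessLib

/-!
# Even-torus link reflection positivity with positive-definite EXPONENTIAL weights on the cut plaquettes

Support file for item stmt-QuantumFields-20194 (`DirichletWindow.AllSidesCouplingChessboard`, K1 of the large-field
sparsity line; seat ym-dw-p1 g3).  Even-side companion of the tree's `…BalabanLadderIROddTorusCutWeightRP`.

On the even torus `(ℤ/Lℤ)^d`, `L = 2m`, the Osterwalder–Seiler LINK reflection `θ t = 1 - t` (hyperplanes between the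
slices `0 | 1` and `m | m+1`) CUTS the temporal plaquettes based at `t = 0` and at `t = m` (`WilsonRP.IsCrossPlaq`).
The chessboard estimate for plaquette sets of all orientations needs, in the link-reflection Cauchy–Schwarz step,
Chebyshev weights ON these cut plaquettes; such weights must be positive-definite class functions of the cut
holonomy.  As on odd tori:

* `wilsonExpectation_mul_timeReflect_mul_prod_pow_nonneg_even` — for `β ≥ 0`, `K` real bounded measurable depending on
  the positive-time links `P`, a finite set `E` of cut plaquettes and exponents `n`,
  `0 ≤ ⟨K · (K ∘ Θ) · ∏_{q ∈ E} (Re tr ρ U_q)^{n_q}⟩_{Λ,β}` — from the tree's COVARIANT even reflection positivity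
  `wilsonExpectation_nonneg_of_covariant` (Gram words in the letters `WilsonRP.coeff ρ hρ 1`);
* `wilsonExpectation_mul_timeReflect_mul_expCut_nonneg_even` — hence, for `c ≥ 0`,
  `0 ≤ ⟨K · (K ∘ Θ) · exp(c ∑_{q ∈ E} Re tr ρ U_q)⟩_{Λ,β}` (truncated exponentials, dominated convergence; the
  truncations `OddTorusChessboard.expCutTrunc` of the odd file are parity-free and reused).

HONEST FRAMING: finite-torus reflection-positivity bookkeeping over tree theorems; nothing here is a statement about the
mass gap or about infinite volume.  References: Osterwalder–Seiler, Ann. Phys. 110 (1978) §2; Seiler LNP 159 Ch. 2;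
Fröhlich–Israel–Lieb–Simon, CMP 62 (1978) Thm. 2.1.
-/

noncomputable section

open MeasureTheory Finset Complex Filter Topology
open scoped ComplexOrder ComplexConjugate BigOperators
open Literature.MathematicalPhysics.QuantumFieldTheory
open Literature.MathematicalPhysics.QuantumFieldTheory.WilsonRP
open Summit.QuantumFields.YangMills.Theorems.OddTorusChessboard (expCutTrunc abs_expCutTrunc_le measurable_expCutTrunc
  tendsto_expCutTrunc)

namespace Summit.QuantumFields.YangMills.Theorems.AllSidesChessboard

variable {d L N : ℕ} [NeZero d] [NeZero L] {G : Type*} [Group G] [TopologicalSpace G]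
  [IsTopologicalGroup G] [CompactSpace G] [MeasurableSpace G] [BorelSpace G]
  (ρ : G →* Matrix (Fin N) (Fin N) ℂ)

/-! ### §1. The positive-time links and the cut links (even torus, link reflection) -/

section Links

variable [Fact (1 < L)]

omit [TopologicalSpace G] [IsTopologicalGroup G] [CompactSpace G] [MeasurableSpace G] [BorelSpace G] in
/-- A positive-time link is not a cut link. -/
theorem not_isCrossEdge_of_mem_posEdges (hL : Even L) {e : Edge d L}
    (he : e ∈ ((posEdges : Finset (Edge d L)) : Set (Edge d L))) : ¬ IsCrossEdge e := fun hc =>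
  not_isPosEdge_of_isCrossEdge hL hc (mem_posEdges.1 he)

omit [TopologicalSpace G] [IsTopologicalGroup G] [CompactSpace G] [MeasurableSpace G] [BorelSpace G] in
/-- The Osterwalder–Seiler substitution on the cut links does not move the positive-time links. -/
theorem translate_apply_of_mem_posEdges (hL : Even L) (Y U : GaugeConfig d L G) {e : Edge d L}
    (he : e ∈ ((posEdges : Finset (Edge d L)) : Set (Edge d L))) : translate Y U e = U e :=
  translate_apply_of_not_isCrossEdge Y U (not_isCrossEdge_of_mem_posEdges hL he)

omit [Group G] [TopologicalSpace G] [IsTopologicalGroup G] [CompactSpace G] [MeasurableSpace G] [BorelSpace G] in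
/-- The splice of the cut links does not move the positive-time links. -/
theorem splice_apply_of_mem_posEdges (hL : Even L) (U Y : GaugeConfig d L G) {e : Edge d L}
    (he : e ∈ ((posEdges : Finset (Edge d L)) : Set (Edge d L))) :
    LatticeRP.splice crossEdges (U, Y) e = U e :=
  splice_apply_of_not_isCrossEdge U Y (not_isCrossEdge_of_mem_posEdges hL he)

omit [TopologicalSpace G] [IsTopologicalGroup G] [CompactSpace G] [MeasurableSpace G] [BorelSpace G] in
/-- The reflected configuration read on the positive-time links does not see the substitution on the cut links. -/
theorem timeReflect_translate_apply_of_mem_posEdges (hL : Even L) (Y U : GaugeConfig d L G) {e : Edge d L}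
    (he : e ∈ ((posEdges : Finset (Edge d L)) : Set (Edge d L))) :
    (translate Y U).timeReflect e = U.timeReflect e := by
  have hne : ¬ IsCrossEdge (edgeReflect e) := not_isCrossEdge_edgeReflect hL (mem_posEdges.1 he)
  rw [timeReflect_apply, timeReflect_apply, translate_apply_of_not_isCrossEdge Y U hne]

end Links

/-! ### §2. The crossing identity per cut plaquette, with the letters `coeff ρ hρ 1` -/

omit [MeasurableSpace G] [BorelSpace G] in
/-- **The Gram form of one cut plaquette (even torus).**  For a crossing plaquette `q`,
`Re tr ρ((translate Y U)_q) = ∑_{k,l,s} a_{(q,k,l,s)}(splice(U,Y)) conj a_{(q,k,l,s)}(ΘU)` with the tree's letters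
`a = coeff ρ hρ 1`. -/
theorem sum_coeff_one_mul_conj [Fact (1 < L)] (hL : Even L) (hρ : Continuous ρ) (U Y : GaugeConfig d L G)
    {q : Plaquette d L} (hq : IsCrossPlaq q) :
    ∑ i : Fin N × Fin N × Bool, coeff ρ hρ 1 (q, i) (LatticeRP.splice crossEdges (U, Y)) *
        conj (coeff ρ hρ 1 (q, i) U.timeReflect) =
      ((plaqRe ρ (translate Y U) q : ℝ) : ℂ) := by
  have hs : (Real.sqrt (1 / 2) : ℂ) * (Real.sqrt (1 / 2) : ℂ) = ((1 / 2 : ℝ) : ℂ) := by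
    rw [← Complex.ofReal_mul, Real.mul_self_sqrt (by norm_num)]
  rw [plaqRe_translate_of_isCrossPlaq ρ hL hρ U Y hq, Complex.ofReal_sum, Fintype.sum_prod_type]
  refine Finset.sum_congr rfl fun k _ => ?_
  rw [Complex.ofReal_sum, Fintype.sum_prod_type]
  refine Finset.sum_congr rfl fun l _ => ?_
  rw [Fintype.sum_bool]
  simp only [coeff, if_pos hq, ↓reduceIte, Bool.false_eq_true, map_mul, Complex.conj_ofReal,
    Complex.conj_conj]
  set u := Literature.RepresentationTheory.CompactGroups.CompactGroup.unitarize ρ hρ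
    (halfPlaq q (LatticeRP.splice crossEdges (U, Y))) k l
  set v := Literature.RepresentationTheory.CompactGroups.CompactGroup.unitarize ρ hρ
    (halfPlaq q U.timeReflect) k l
  calc (Real.sqrt (1 / 2) : ℂ) * u * ((Real.sqrt (1 / 2) : ℂ) * (starRingEnd ℂ) v) +
        (Real.sqrt (1 / 2) : ℂ) * (starRingEnd ℂ) u * ((Real.sqrt (1 / 2) : ℂ) * v)
      = ((Real.sqrt (1 / 2) : ℂ) * (Real.sqrt (1 / 2) : ℂ)) *
          (u * (starRingEnd ℂ) v + (starRingEnd ℂ) (u * (starRingEnd ℂ) v)) := by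
        simp only [map_mul, Complex.conj_conj]; ring
    _ = (((u * (starRingEnd ℂ) v).re : ℝ) : ℂ) := by
        rw [hs, Complex.add_conj]; push_cast; ring

/-! ### §3. The monomial lemma -/

section Monomial

variable [Fact (1 < L)]

/-- The Gram words of the monomial `∏_{q ∈ E} (Re tr ρ U_q)^{n_q}` against the observable `K` (even torus):
`g_w(V) = K(V) · ∏_{t} a_{(q_t, w_t)}(V)`. -/
def gramWordE (hρ : Continuous ρ) (K : GaugeConfig d L G → ℝ) (E : Finset (Plaquette d L)) (n : E → ℕ)
    (w : (Σ q : E, Fin (n q)) → Fin N × Fin N × Bool) (V : GaugeConfig d L G) : ℂ :=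
  (K V : ℂ) * ∏ t : (Σ q : E, Fin (n q)), coeff ρ hρ 1 ((t.1 : Plaquette d L), w t) V

set_option synthInstance.maxSize 512 in
/-- **Monomial lemma (even torus).**  `L` even, `β ≥ 0`, continuous `ρ`: for a real bounded measurable `K` depending
only on the positive-time links `P`, a finite set `E` of CUT plaquettes and exponents `n`,
`0 ≤ ⟨K · (K ∘ Θ) · ∏_{q ∈ E} (Re tr ρ U_q)^{n_q}⟩_{Λ,β}`. -/
theorem wilsonExpectation_mul_timeReflect_mul_prod_pow_nonneg_even (hL : Even L) (hρ : Continuous ρ)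
    {β : ℝ} (hβ : 0 ≤ β) {K : GaugeConfig d L G → ℝ} (hKm : Measurable K) {K₀ : ℝ} (hKb : ∀ U, |K U| ≤ K₀)
    (hKdep : DependsOn K ((posEdges : Finset (Edge d L)) : Set (Edge d L)))
    (E : Finset (Plaquette d L)) (hE : ∀ q ∈ E, IsCrossPlaq q) (n : E → ℕ) :
    0 ≤ wilsonExpectation ρ β fun U : GaugeConfig d L G =>
      K U * K U.timeReflect * ∏ q : E, plaqRe ρ U q ^ n q := by
  classical
  set Φ : GaugeConfig d L G → ℂ := fun U =>
    ((K U * K U.timeReflect * ∏ q : E, plaqRe ρ U q ^ n q : ℝ) : ℂ) with hΦ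
  have hreal : wilsonExpectation ρ β Φ =
      ((wilsonExpectation ρ β fun U : GaugeConfig d L G =>
        K U * K U.timeReflect * ∏ q : E, plaqRe ρ U q ^ n q : ℝ) : ℂ) := by
    unfold wilsonExpectation
    exact integral_ofReal
  suffices h : 0 ≤ wilsonExpectation ρ β Φ by
    rw [hreal] at h
    exact Complex.zero_le_real.1 h
  have hΘm : Measurable (GaugeConfig.timeReflect : GaugeConfig d L G → GaugeConfig d L G) :=
    measurable_timeReflect
  have hΦm : Measurable Φ := by
    refine Complex.measurable_ofReal.comp ?_
    exact (hKm.mul (hKm.comp hΘm)).mul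
      (Finset.measurable_prod _ fun q _ => (measurable_plaqRe ρ hρ _).pow_const _)
  have hgm : ∀ w, Measurable (gramWordE ρ hρ K E n w) := fun w =>
    (Complex.measurable_ofReal.comp hKm).mul
      (Finset.measurable_prod _ fun t _ => measurable_coeff ρ hρ 1 _)
  have hK0 : 0 ≤ K₀ := (abs_nonneg _).trans (hKb (fun _ => 1))
  have hgb : ∀ w U, ‖gramWordE ρ hρ K E n w U‖ ≤ K₀ := by
    intro w U
    rw [gramWordE, norm_mul, Complex.norm_real, Real.norm_eq_abs]
    refine (mul_le_mul_of_nonneg_left ?_ (abs_nonneg _)).trans ((mul_one _).le.trans (hKb U))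
    rw [norm_prod]
    refine Finset.prod_le_one (fun _ _ => norm_nonneg _) fun t _ => ?_
    refine (norm_coeff_le ρ hρ 1 _ _).trans ?_
    calc Real.sqrt (1 / 2) ≤ Real.sqrt 1 := Real.sqrt_le_sqrt (by norm_num)
      _ = 1 := Real.sqrt_one
  have hsub : ((posEdges : Finset (Edge d L)) : Set (Edge d L)) ⊆
      ((posEdges ∪ crossEdges : Finset (Edge d L)) : Set (Edge d L)) := by
    intro e he
    rw [Finset.coe_union]
    exact Or.inl he
  have hgdep : ∀ w, DependsOn (gramWordE ρ hρ K E n w)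
      ((posEdges ∪ crossEdges : Finset (Edge d L)) : Set (Edge d L)) := by
    intro w U V hUV
    simp only [gramWordE]
    rw [hKdep fun e he => hUV e (hsub he)]
    congr 1
    exact Finset.prod_congr rfl fun t _ => dependsOn_coeff ρ hL hρ 1 _ hUV
  refine wilsonExpectation_nonneg_of_covariant ρ hL hρ hβ hgm hgb hgdep hΦm fun U Y => ?_
  set z := LatticeRP.splice crossEdges (U, Y) with hz
  have hK1 : K (translate Y U) = K z :=
    hKdep fun e he => by rw [translate_apply_of_mem_posEdges hL Y U he, hz, splice_apply_of_mem_posEdges hL U Y he]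
  have hK2 : K (translate Y U).timeReflect = K U.timeReflect :=
    hKdep fun e he => timeReflect_translate_apply_of_mem_posEdges hL Y U he
  have hrhs : ∑ w, gramWordE ρ hρ K E n w z * conj (gramWordE ρ hρ K E n w U.timeReflect) =
      (K z : ℂ) * (K U.timeReflect : ℂ) *
        ∏ t : (Σ q : E, Fin (n q)), ∑ i : Fin N × Fin N × Bool,
          coeff ρ hρ 1 ((t.1 : Plaquette d L), i) z * conj (coeff ρ hρ 1 ((t.1 : Plaquette d L), i) U.timeReflect) := by
    rw [Fintype.prod_sum, Finset.mul_sum]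
    refine Finset.sum_congr rfl fun w _ => ?_
    simp only [gramWordE, map_mul, map_prod, Complex.conj_ofReal]
    rw [Finset.prod_mul_distrib]
    ring
  rw [hrhs]
  have hlet : ∀ t : (Σ q : E, Fin (n q)),
      ∑ i : Fin N × Fin N × Bool, coeff ρ hρ 1 ((t.1 : Plaquette d L), i) z *
          conj (coeff ρ hρ 1 ((t.1 : Plaquette d L), i) U.timeReflect) =
        ((plaqRe ρ (translate Y U) t.1 : ℝ) : ℂ) :=
    fun t => sum_coeff_one_mul_conj ρ hL hρ U Y (hE _ t.1.2)
  simp_rw [hlet]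
  have hpow : ∏ t : (Σ q : E, Fin (n q)), ((plaqRe ρ (translate Y U) t.1 : ℝ) : ℂ) =
      ∏ q : E, ((plaqRe ρ (translate Y U) q : ℝ) : ℂ) ^ n q := by
    rw [← Finset.univ_sigma_univ, Finset.prod_sigma]
    refine Finset.prod_congr rfl fun q _ => ?_
    dsimp only
    rw [Finset.prod_const, Finset.card_univ, Fintype.card_fin]
  rw [hpow, hΦ]
  simp only
  rw [hK1, hK2]
  push_cast
  ring

end Monomial

/-! ### §4. Exponential weights on the cut plaquettes -/

section Exponential

variable [Fact (1 < L)]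

/-- **Exponential cut weights are link-reflection positive on the even torus.**  `L` even, `β ≥ 0`, continuous `ρ`:
for `c ≥ 0`, a real bounded measurable `K` depending only on the positive-time links `P`, and a finite set `E` of CUT
plaquettes, `0 ≤ ⟨K · (K ∘ Θ) · exp(c ∑_{q ∈ E} Re tr ρ U_q)⟩_{Λ,β}`. -/
theorem wilsonExpectation_mul_timeReflect_mul_expCut_nonneg_even (hL : Even L) (hρ : Continuous ρ)
    {β : ℝ} (hβ : 0 ≤ β) {c : ℝ} (hc : 0 ≤ c) {K : GaugeConfig d L G → ℝ} (hKm : Measurable K) {K₀ : ℝ}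
    (hKb : ∀ U, |K U| ≤ K₀) (hKdep : DependsOn K ((posEdges : Finset (Edge d L)) : Set (Edge d L)))
    (E : Finset (Plaquette d L)) (hE : ∀ q ∈ E, IsCrossPlaq q) :
    0 ≤ wilsonExpectation ρ β fun U : GaugeConfig d L G =>
      K U * K U.timeReflect * Real.exp (c * ∑ q ∈ E, plaqRe ρ U q) := by
  classical
  haveI := isProbabilityMeasure_wilsonMeasure (d := d) (L := L) (G := G) ρ hρ β
  have hΘm : Measurable (GaugeConfig.timeReflect : GaugeConfig d L G → GaugeConfig d L G) :=
    measurable_timeReflect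
  have hK0 : 0 ≤ K₀ := (abs_nonneg _).trans (hKb (fun _ => 1))
  have hKK : ∀ U : GaugeConfig d L G, |K U * K U.timeReflect| ≤ K₀ * K₀ := fun U => by
    rw [abs_mul]; exact mul_le_mul (hKb _) (hKb _) (abs_nonneg _) hK0
  set F : ℕ → GaugeConfig d L G → ℝ := fun M U => K U * K U.timeReflect * expCutTrunc ρ c E M U with hF
  have hFnonneg : ∀ M, 0 ≤ ∫ U, F M U ∂(wilsonMeasure ρ β) := by
    intro M
    have hexp : ∀ U : GaugeConfig d L G, F M U =
        ∑ n ∈ Fintype.piFinset (fun _ : E => Finset.range M),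
          (∏ q : E, c ^ n q / ((n q).factorial : ℝ)) * (K U * K U.timeReflect * ∏ q : E, plaqRe ρ U q ^ n q) := by
      intro U
      simp only [hF, expCutTrunc]
      rw [Finset.prod_univ_sum, Finset.mul_sum]
      refine Finset.sum_congr rfl fun n _ => ?_
      rw [show (∏ q : E, (c * plaqRe ρ U q) ^ n q / ((n q).factorial : ℝ)) =
          (∏ q : E, c ^ n q / ((n q).factorial : ℝ)) * ∏ q : E, plaqRe ρ U q ^ n q by
        rw [← Finset.prod_mul_distrib]
        refine Finset.prod_congr rfl fun q _ => ?_
        rw [mul_pow]; ring]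
      ring
    have hint : ∀ n : E → ℕ, Integrable (fun U : GaugeConfig d L G =>
        (∏ q : E, c ^ n q / ((n q).factorial : ℝ)) * (K U * K U.timeReflect * ∏ q : E, plaqRe ρ U q ^ n q))
        (wilsonMeasure ρ β) := by
      intro n
      refine Integrable.const_mul ?_ _
      refine Integrable.of_bound (((hKm.mul (hKm.comp hΘm)).mul
        (Finset.measurable_prod _ fun q _ => (measurable_plaqRe ρ hρ _).pow_const _)).aestronglyMeasurable)
        (K₀ * K₀ * ∏ q : E, (N : ℝ) ^ n q) (ae_of_all _ fun U => ?_)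
      rw [Real.norm_eq_abs, abs_mul, Finset.abs_prod]
      refine mul_le_mul (hKK U) (Finset.prod_le_prod (fun _ _ => abs_nonneg _) fun q _ => ?_)
        (Finset.prod_nonneg fun _ _ => abs_nonneg _) (mul_nonneg hK0 hK0)
      rw [abs_pow]
      exact pow_le_pow_left₀ (abs_nonneg _) (abs_plaqRe_le ρ hρ U q) _
    rw [integral_congr_ae (ae_of_all _ hexp), integral_finsetSum _ fun n _ => hint n]
    refine Finset.sum_nonneg fun n _ => ?_
    rw [integral_const_mul]
    refine mul_nonneg (Finset.prod_nonneg fun q _ => div_nonneg (pow_nonneg hc _) (Nat.cast_nonneg _)) ?_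
    exact wilsonExpectation_mul_timeReflect_mul_prod_pow_nonneg_even ρ hL hρ hβ hKm hKb hKdep E hE n
  have hlim : Tendsto (fun M => ∫ U, F M U ∂(wilsonMeasure ρ β)) atTop
      (𝓝 (∫ U, K U * K U.timeReflect * Real.exp (c * ∑ q ∈ E, plaqRe ρ U q) ∂(wilsonMeasure ρ β))) := by
    refine tendsto_integral_of_dominated_convergence (fun _ => K₀ * K₀ * Real.exp (|c| * N) ^ E.card)
      (fun M => ((hKm.mul (hKm.comp hΘm)).mul (measurable_expCutTrunc ρ hρ c E M)).aestronglyMeasurable)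
      (integrable_const _) (fun M => ae_of_all _ fun U => ?_) (ae_of_all _ fun U => ?_)
    · rw [hF, Real.norm_eq_abs, abs_mul]
      exact mul_le_mul (hKK U) (abs_expCutTrunc_le ρ hρ c E M U) (abs_nonneg _) (mul_nonneg hK0 hK0)
    · exact (tendsto_expCutTrunc ρ c E U).const_mul _
  exact ge_of_tendsto' hlim hFnonneg

end Exponential

end Summit.QuantumFields.YangMills.Theorems.AllSidesChessboard

end
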